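import Mathlib.Algebra.Module.PUnit
import Mathlib.FieldTheory.KrullTopology
import Mathlib.RingTheory.Valuation.RamificationGroup
import Mathlib.RingTheory.Valuation.LocalSubring
import Mathlib.NumberTheory.NumberField.InfinitePlace.Ramification
import Literature.IUT.HodgeTheaters.GlobalFrobenioidsModel
import Literature.AnabelianGeometry.AbsoluteAnabelian.FundamentalExtension
import HarnessLib

/-!
# [IUTchI] Example 5.1 (iv): the interface `BirationalData` is inhabited by the GENUINE Galois pair
# `G_F ↷ F̄ˣ` with valuation rings as primes, and its typed predicate `DecompIsStabilizer` holds there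
# (NV-L5, proof-only)

S. Mochizuki, *Inter-universal Teichmüller theory I*, §5, Example 5.1 (iv), kurims manuscript (May 2020)
p. 126 [claim: Mochizuki2012, status: disputed]: "… by considering the elements of `Aut_{†ℱ^⊛}(A)` that
fix the submonoid `𝒪^⊿_𝔭`, for some system of `𝔭`'s lying over `𝔭₀`, we obtain a closed subgroup
`Π_{𝔭₀} ⊆ π₁(†𝒟^⊛)`, i.e. the decomposition group of `𝔭₀`"; "`𝒪^×(A^birat)` … the multiplicative group
of the number field of `A`"; the pair "`π₁(†𝒟^⊛) ↷ 𝒪̃^⊛×`".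

The tree types part (iv) as the INTERFACE `Literature.IUT.HodgeTheaters.BirationalData G` (abc-iut-L5
lineage, `GlobalFrobenioidsModel.lean`): a discrete `G`-module `𝒪̃^⊛×` with open stabilisers, primes `𝔭`
with integral submonoids `𝒪^⊿_𝔭`, primes `𝔭₀` with decomposition groups, and the printed description of
`Π_{𝔭₀}` as the predicate `DecompIsStabilizer`.  This PROOF-ONLY file (0 `def`s; NV-L5 row
`BirationalData`, L5-lead RULINGS #27) proves, for every field `F` of characteristic zero (print: the
number field `F_mod`; `G := G_F` = the tree's `absoluteGaloisGrp F`):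

* `nonempty_model`, `exists_model_decompIsStabilizer` — the interface is inhabited by the `_model`
  datum `𝒪̃^⊛× := F̄ˣ` with its Galois action (stabilisers open: Krull topology, Mathlib
  `stabilizer_isOpen_of_isIntegral`), `𝔭` := the valuation rings `𝒪_𝔭 ⊆ F̄` (Mathlib `ValuationSubring`),
  `𝒪^⊿_𝔭 := F̄ˣ ∩ 𝒪_𝔭`, `𝔭₀ := 𝔭 ∩ F` (the valuation rings of `F` lying under one of `F̄`), `Π_{𝔭₀}` := the
  stabiliser of a chosen `𝔭` over `𝔭₀` (Mathlib `ValuationSubring.decompositionSubgroup`-shape), and AT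
  THIS DATUM the typed predicate `DecompIsStabilizer` ("`Π_{𝔭₀}` = the automorphisms fixing `𝒪^⊿_𝔭` for
  some `𝔭` over `𝔭₀`") is a THEOREM (`σ • 𝒪_𝔭 = 𝒪_𝔭 ⟺ σ` preserves `F̄ˣ ∩ 𝒪_𝔭`, since `0 ∈ 𝒪_𝔭`).
  HONEST LABEL `_model` with two stated simplifications: archimedean primes are not represented
  (valuation rings only; the trivial ring `F̄` is the non-proper one), and `𝔭₀` ranges over the valuation
  rings of `F` that DO lie under a valuation ring of `F̄` (all of them, by Chevalley's extension theorem —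
  not used, not claimed);
* `exists_degenerate_not_decompIsStabilizer` — a `_degenerate` parameter record (no primes over `𝔭₀`)
  at which `DecompIsStabilizer` FAILS: the typed predicate is a genuine constraint on the data, not a
  tautology of the interface (flagged degenerate; evidence of non-tautology only).

Nothing of the series is asserted; no side is taken on [IUTchIII] Cor. 3.12; instantiated ≠ endorsed.
-/

noncomputable section

namespace Literature.IUT.HodgeTheaters

namespace BirationalData

open scoped Pointwise
open Literature.AnabelianGeometry.AbsoluteAnabelian (absoluteGaloisGrp)

universe u

variable (F : Type u) [Field F] [CharZero F]

-- `G_F` acts on `F̄ˣ` coordinatewise, `(σ • u : F̄) = σ • (u : F̄)`: Mathlib's `Units.mulDistribMulActionRight`, supplied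
-- EXPLICITLY below via `letI` (nothing is registered globally or locally in this file).

/-- Under the units action the stabiliser of `u ∈ F̄ˣ` is the stabiliser of `u ∈ F̄`. [folklore] -/
private theorem coe_stabilizer_units (u : (AlgebraicClosure F)ˣ) :
    letI : MulDistribMulAction (absoluteGaloisGrp F) (AlgebraicClosure F)ˣ := Units.mulDistribMulActionRight
    (MulAction.stabilizer (absoluteGaloisGrp F) u : Set (absoluteGaloisGrp F)) =
      MulAction.stabilizer (Field.absoluteGaloisGroup F) (u : AlgebraicClosure F) := by
  letI : MulDistribMulAction (absoluteGaloisGrp F) (AlgebraicClosure F)ˣ := Units.mulDistribMulActionRight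
  ext σ
  simp only [SetLike.mem_coe, MulAction.mem_stabilizer_iff, Units.ext_iff]
  rfl

/-- Stabilisers of elements of `F̄ˣ` in `G_F` are open (Krull topology; `F(u)/F` is finite). [folklore] -/
private theorem isOpen_stabilizer_units (u : (AlgebraicClosure F)ˣ) :
    letI : MulDistribMulAction (absoluteGaloisGrp F) (AlgebraicClosure F)ˣ := Units.mulDistribMulActionRight
    IsOpen (MulAction.stabilizer (absoluteGaloisGrp F) u : Set (absoluteGaloisGrp F)) := by
  letI : MulDistribMulAction (absoluteGaloisGrp F) (AlgebraicClosure F)ˣ := Units.mulDistribMulActionRight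
  rw [coe_stabilizer_units]
  exact stabilizer_isOpen_of_isIntegral (K := F) (L := AlgebraicClosure F) (u : AlgebraicClosure F)

/-- For a valuation ring `𝒪 ⊆ F̄` and `σ ∈ G_F`: `σ • 𝒪 = 𝒪` iff `σ` preserves membership of UNITS in `𝒪`
(every nonzero element is a unit and `0 ∈ 𝒪`). [folklore] -/
private theorem smul_valuationSubring_eq_iff (A : ValuationSubring (AlgebraicClosure F))
    (σ : absoluteGaloisGrp F) :
    letI : MulDistribMulAction (absoluteGaloisGrp F) (AlgebraicClosure F)ˣ := Units.mulDistribMulActionRight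
    σ • A = A ↔ ∀ x : (AlgebraicClosure F)ˣ,
      (x : AlgebraicClosure F) ∈ A ↔ ((σ • x : (AlgebraicClosure F)ˣ) : AlgebraicClosure F) ∈ A := by
  letI : MulDistribMulAction (absoluteGaloisGrp F) (AlgebraicClosure F)ˣ := Units.mulDistribMulActionRight
  constructor
  · intro h x
    show (x : AlgebraicClosure F) ∈ A ↔ σ • (x : AlgebraicClosure F) ∈ A
    conv_rhs => rw [← h]
    exact ValuationSubring.smul_mem_pointwise_smul_iff.symm
  · intro h
    ext y
    rw [ValuationSubring.mem_pointwise_smul_iff_inv_smul_mem]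
    by_cases hy : y = 0
    · subst hy
      simp
    · have hy' : σ⁻¹ • y ≠ 0 := by rwa [Ne, smul_eq_zero_iff_eq]
      have hx := h (Units.mk0 (σ⁻¹ • y) hy')
      have hval : ((σ • Units.mk0 (σ⁻¹ • y) hy' : (AlgebraicClosure F)ˣ) :
          AlgebraicClosure F) = σ • σ⁻¹ • y := rfl
      rw [hval, smul_inv_smul] at hx
      exact hx

/-- **NV-L5 `BirationalData` (`_model`).**  For a field `F` of characteristic zero, the interface of
[IUTchI] Ex. 5.1 (iv) over `G_F` is inhabited by the genuine pair `G_F ↷ F̄ˣ` (discrete: stabilisers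
open), primes `𝔭 :=` valuation rings of `F̄` with `𝒪^⊿_𝔭 := F̄ˣ ∩ 𝒪_𝔭`, `𝔭₀ := 𝔭 ∩ F`, `Π_{𝔭₀} :=` the
stabiliser of a chosen `𝔭` over `𝔭₀`, nonarchimedean flag `:= (𝔭₀ ≠ F)`.  Simplifications (said):
no archimedean primes; `𝔭₀` ranges over valuation rings of `F` under some `𝔭`. ([IUTchI] Ex 5.1 (iv) p.126)
[claim: Mochizuki2012, status: disputed] -/
theorem nonempty_model : Nonempty (BirationalData (absoluteGaloisGrp F)) :=
  ⟨{ Otilde := (AlgebraicClosure F)ˣ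
     otildeAction := Units.mulDistribMulActionRight
     isOpen_stabilizer := isOpen_stabilizer_units F
     PrimeIdx := ValuationSubring (AlgebraicClosure F)
     Oint := fun A => A.toSubring.toSubmonoid.comap (Units.coeHom (AlgebraicClosure F))
     PrimeIdx0 := {A₀ : ValuationSubring F //
       ∃ A : ValuationSubring (AlgebraicClosure F), A.comap (algebraMap F (AlgebraicClosure F)) = A₀}
     over := fun A => ⟨A.comap (algebraMap F (AlgebraicClosure F)), A, rfl⟩
     decomp := fun A₀ => MulAction.stabilizer (absoluteGaloisGrp F) (Classical.choose A₀.2)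
     IsNonarch := fun A₀ => A₀.1 ≠ ⊤ }⟩

/-- **At the Galois model the printed description of `Π_{𝔭₀}` is a THEOREM**: there is a `BirationalData`
over `G_F` — the `_model` datum of `nonempty_model`: `𝒪̃^⊛× = F̄ˣ` with the Galois action, valuation rings
as primes — satisfying the typed predicate `DecompIsStabilizer` ("the elements … that fix the submonoid
`𝒪^⊿_𝔭`, for some `𝔭` lying over `𝔭₀`" IS the decomposition group), whose module is `F̄ˣ` on the nose.
([IUTchI] Ex 5.1 (iv) p.126) [claim: Mochizuki2012, status: disputed] -/
theorem exists_model_decompIsStabilizer :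
    ∃ β : BirationalData (absoluteGaloisGrp F), β.DecompIsStabilizer ∧
      Nonempty (β.Otilde ≃* (AlgebraicClosure F)ˣ) := by
  refine ⟨{ Otilde := (AlgebraicClosure F)ˣ
            otildeAction := Units.mulDistribMulActionRight
            isOpen_stabilizer := isOpen_stabilizer_units F
            PrimeIdx := ValuationSubring (AlgebraicClosure F)
            Oint := fun A => A.toSubring.toSubmonoid.comap (Units.coeHom (AlgebraicClosure F))
            PrimeIdx0 := {A₀ : ValuationSubring F //
              ∃ A : ValuationSubring (AlgebraicClosure F), A.comap (algebraMap F (AlgebraicClosure F)) = A₀}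
            over := fun A => ⟨A.comap (algebraMap F (AlgebraicClosure F)), A, rfl⟩
            decomp := fun A₀ => MulAction.stabilizer (absoluteGaloisGrp F) (Classical.choose A₀.2)
            IsNonarch := fun A₀ => A₀.1 ≠ ⊤ }, ⟨fun A₀ => ?_⟩, ⟨MulEquiv.refl _⟩⟩
  refine ⟨Classical.choose A₀.2, Subtype.ext (Classical.choose_spec A₀.2), fun σ => ?_⟩
  rw [MulAction.mem_stabilizer_iff, smul_valuationSubring_eq_iff]
  rfl

/-- Instance: over `F_mod := ℚ` the Galois model inhabits the interface and satisfies the typed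
description of the decomposition groups. ([IUTchI] Ex 5.1 (iv) p.126) [claim: Mochizuki2012, status: disputed] -/
example : ∃ β : BirationalData (absoluteGaloisGrp ℚ), β.DecompIsStabilizer :=
  (exists_model_decompIsStabilizer ℚ).imp fun _ h => h.1

omit [CharZero F] in
/-- **`DecompIsStabilizer` is NOT a tautology of the interface**: at the `_degenerate` parameter record
over ANY profinite `G` with trivial module `𝒪̃^⊛× := 1`, NO primes `𝔭` and one prime `𝔭₀`, the clause
"for some `𝔭` lying over `𝔭₀`" fails.  Flagged degenerate: evidence that the typed predicate constrains
the data, nothing more. ([IUTchI] Ex 5.1 (iv) p.126) [claim: Mochizuki2012, status: disputed] -/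
theorem exists_degenerate_not_decompIsStabilizer (G : ProfiniteGrp.{u}) :
    ∃ β : BirationalData G, ¬ β.DecompIsStabilizer :=
  ⟨{ Otilde := PUnit
     isOpen_stabilizer := fun _ => by
       rw [show (MulAction.stabilizer G (PUnit.unit : PUnit.{u + 1}) : Set G) = Set.univ from
         Set.eq_univ_of_forall fun _ => Subsingleton.elim _ _]
       exact isOpen_univ
     PrimeIdx := PEmpty
     Oint := fun e => e.elim
     PrimeIdx0 := PUnit
     over := fun e => e.elim
     decomp := fun _ => ⊤
     IsNonarch := fun _ => True },
   fun h => by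
     obtain ⟨e, -⟩ := h.out PUnit.unit
     exact e.elim⟩

/-! ### Appendix (same seat, later the same night): ALL primes `𝔭₀` of `F` — Chevalley's extension theorem
removes the second simplification of `nonempty_model` -/

omit [CharZero F] in
/-- **Chevalley's extension theorem, the form used here**: every valuation ring `𝒪₀` of `F` is the trace
`𝒪 ∩ F` of some valuation ring `𝒪` of any extension field `K ⊇ F` (Mathlib's
`IsLocalRing.exists_factor_valuationRing` gives `𝒪 ⊇ 𝒪₀` with LOCAL inclusion; a valuation ring admits no
proper local over-ring inside its field, so the trace is `𝒪₀` itself). [folklore] -/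
private theorem exists_comap_eq (K : Type*) [Field K] [Algebra F K] (A₀ : ValuationSubring F) :
    ∃ A : ValuationSubring K, A.comap (algebraMap F K) = A₀ := by
  obtain ⟨A, hA, hloc⟩ := IsLocalRing.exists_factor_valuationRing ((algebraMap F K).comp A₀.subtype)
  refine ⟨A, ?_⟩
  ext x
  rw [ValuationSubring.mem_comap]
  refine ⟨fun hx => ?_, fun hx => hA ⟨x, hx⟩⟩
  by_contra hx0
  have hx_ne : x ≠ 0 := by rintro rfl; exact hx0 A₀.zero_mem
  have hinv : x⁻¹ ∈ A₀ := (A₀.mem_or_inv_mem x).resolve_left hx0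
  -- `x⁻¹ ∈ 𝒪₀` maps to a UNIT of `𝒪` (its inverse `x` lies in `𝒪`) …
  have hunit : IsUnit ((((algebraMap F K).comp A₀.subtype).codRestrict A.toSubring hA) ⟨x⁻¹, hinv⟩) := by
    refine isUnit_iff_exists_inv.mpr ⟨⟨algebraMap F K x, hx⟩, Subtype.ext ?_⟩
    show algebraMap F K (x⁻¹ : F) * algebraMap F K x = 1
    rw [← map_mul, inv_mul_cancel₀ hx_ne, map_one]
  -- … so, the inclusion being local, `x⁻¹` is a unit of `𝒪₀`, i.e. `x ∈ 𝒪₀`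
  obtain ⟨w, hw⟩ := (hloc.map_nonunit _ hunit).exists_right_inv
  have hwx : (w : F) = x := by
    have h := congrArg Subtype.val hw
    simp only [A₀.toSubring.coe_mul, OneMemClass.coe_one] at h
    exact ((inv_mul_eq_one₀ hx_ne).1 h).symm
  exact hx0 (hwx ▸ w.2)

/-- **NV-L5 `BirationalData` (`_model`, all primes of `F`).**  As `exists_model_decompIsStabilizer`, but with
`𝔭₀` ranging over ALL valuation rings of `F` (`PrimeIdx0 := ValuationSubring F` on the nose, `𝔭 ↦ 𝔭 ∩ F`
SURJECTIVE by Chevalley's extension theorem `exists_comap_eq`): the Galois model `G_F ↷ F̄ˣ` with valuation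
rings of `F̄` as primes satisfies the typed printed description `DecompIsStabilizer` of the decomposition
groups `Π_{𝔭₀}` for every prime `𝔭₀` of `F`.  Remaining stated simplification: archimedean primes are not
represented (valuation rings only; `IsNonarch := (𝔭₀ ≠ F)`). ([IUTchI] Ex 5.1 (iv) p.126)
[claim: Mochizuki2012, status: disputed] -/
theorem exists_model_decompIsStabilizer_allPrimes :
    ∃ β : BirationalData (absoluteGaloisGrp F), β.DecompIsStabilizer ∧
      Nonempty (β.Otilde ≃* (AlgebraicClosure F)ˣ) ∧ Nonempty (β.PrimeIdx0 ≃ ValuationSubring F) ∧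
      Nonempty (β.PrimeIdx ≃ ValuationSubring (AlgebraicClosure F)) := by
  refine ⟨{ Otilde := (AlgebraicClosure F)ˣ
            otildeAction := Units.mulDistribMulActionRight
            isOpen_stabilizer := isOpen_stabilizer_units F
            PrimeIdx := ValuationSubring (AlgebraicClosure F)
            Oint := fun A => A.toSubring.toSubmonoid.comap (Units.coeHom (AlgebraicClosure F))
            PrimeIdx0 := ValuationSubring F
            over := fun A => A.comap (algebraMap F (AlgebraicClosure F))
            decomp := fun A₀ => MulAction.stabilizer (absoluteGaloisGrp F)
              (Classical.choose (exists_comap_eq F (AlgebraicClosure F) A₀))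
            IsNonarch := fun A₀ => A₀ ≠ ⊤ }, ⟨fun A₀ => ?_⟩, ⟨MulEquiv.refl _⟩, ⟨Equiv.refl _⟩,
          ⟨Equiv.refl _⟩⟩
  refine ⟨Classical.choose (exists_comap_eq F (AlgebraicClosure F) A₀),
    Classical.choose_spec (exists_comap_eq F (AlgebraicClosure F) A₀), fun σ => ?_⟩
  rw [MulAction.mem_stabilizer_iff, smul_valuationSubring_eq_iff]
  rfl

/-- Instance: over `F_mod := ℚ`, for EVERY valuation ring `𝔭₀` of `ℚ` (the localisations `ℤ_(p)` and `ℚ`)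
the Galois model carries a prime of `ℚ̄` over it, and the typed description of `Π_{𝔭₀}` holds.
([IUTchI] Ex 5.1 (iv) p.126) [claim: Mochizuki2012, status: disputed] -/
example : ∃ β : BirationalData (absoluteGaloisGrp ℚ), β.DecompIsStabilizer ∧
    Nonempty (β.PrimeIdx0 ≃ ValuationSubring ℚ) :=
  (exists_model_decompIsStabilizer_allPrimes ℚ).imp fun _ h => ⟨h.1, h.2.2.1⟩


/-! ### Appendix 2 (same seat): ARCHIMEDEAN primes too — infinite places of `F̄` with `𝒪^⊿_𝔭 := {|·|_𝔭 ≤ 1}`,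
removing the last stated simplification -/

section InfinitePlaces

open NumberField

variable {L : Type*} [Field L]

/-- `|q|_w = |q|` for a rational number `q` at any infinite place `w` (it comes from an embedding into
`ℂ`). [folklore] -/
private theorem infinitePlace_ratCast (w : InfinitePlace L) (q : ℚ) : w (q : L) = |(q : ℝ)| := by
  rw [← InfinitePlace.norm_embedding_eq, map_ratCast, Complex.norm_ratCast]

/-- One closed unit ball inside another forces the reverse inequality of absolute values (rescale by a
rational number squeezed between `1/|y|_{w'}` and `1/|y|_w`). [folklore] -/
private theorem infinitePlace_le_of_ball (w w' : InfinitePlace L)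
    (h : ∀ x : L, x ≠ 0 → w x ≤ 1 → w' x ≤ 1) (y : L) : w' y ≤ w y := by
  by_contra hlt
  rw [not_le] at hlt
  have hy : y ≠ 0 := by
    rintro rfl
    simp at hlt
  have hw : 0 < w y := (AbsoluteValue.pos_iff w.1).2 hy
  have hw' : 0 < w' y := hw.trans hlt
  obtain ⟨q, hq1, hq2⟩ := exists_rat_btwn (inv_strictAnti₀ hw hlt)
  have hq0 : (0 : ℝ) < q := (inv_pos.2 hw').trans hq1
  have hx1 : w ((q : L) * y) ≤ 1 := by
    rw [map_mul, infinitePlace_ratCast, abs_of_pos hq0]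
    have h1 := mul_lt_mul_of_pos_right hq2 hw
    rw [inv_mul_cancel₀ hw.ne'] at h1
    exact h1.le
  have hx2 : 1 < w' ((q : L) * y) := by
    rw [map_mul, infinitePlace_ratCast, abs_of_pos hq0]
    have h2 := mul_lt_mul_of_pos_right hq1 hw'
    rwa [inv_mul_cancel₀ hw'.ne'] at h2
  have hx0 : (q : L) * y ≠ 0 := fun h0 => by
    rw [h0, map_zero] at hx2
    exact absurd hx2 (by norm_num)
  exact absurd (h _ hx0 hx1) (not_le.2 hx2)

/-- **Two infinite places with the same closed unit ball (on nonzero elements) coincide.** [folklore] -/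
private theorem infinitePlace_eq_of_ball (w w' : InfinitePlace L)
    (h : ∀ x : L, x ≠ 0 → (w x ≤ 1 ↔ w' x ≤ 1)) : w = w' :=
  Subtype.ext <| AbsoluteValue.ext fun y =>
    le_antisymm (infinitePlace_le_of_ball w' w (fun x hx => (h x hx).2) y)
      (infinitePlace_le_of_ball w w' (fun x hx => (h x hx).1) y)

/-- **The stabiliser of an infinite place is the stabiliser of its closed unit ball**: for
`σ ∈ Gal(L/k)`, `σ • w = w` iff `σ` preserves `{|x|_w ≤ 1}` on nonzero elements. [folklore] -/
private theorem smul_infinitePlace_eq_iff {k : Type*} [Field k] [Algebra k L] (σ : L ≃ₐ[k] L)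
    (w : InfinitePlace L) : σ • w = w ↔ ∀ x : L, x ≠ 0 → (w x ≤ 1 ↔ w (σ x) ≤ 1) := by
  constructor
  · intro h x _
    have hx : w (σ.symm (σ x)) = w (σ x) := by rw [← InfinitePlace.smul_apply, h]
    rw [σ.symm_apply_apply] at hx
    rw [hx]
  · intro h
    have h' : σ⁻¹ • w = w := by
      refine (infinitePlace_eq_of_ball w (σ⁻¹ • w) fun x hx => ?_).symm
      rw [InfinitePlace.smul_apply]
      exact h x hx
    rw [← h', smul_smul, mul_inv_cancel, one_smul, h']

end InfinitePlaces

/-- **NV-L5 `BirationalData` (`_model`, ALL primes: valuation rings AND infinite places).**  The Galois model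
`G_F ↷ F̄ˣ` with primes `𝔭 :=` the valuation rings of `F̄` (nonarchimedean, `𝒪^⊿_𝔭 := F̄ˣ ∩ 𝒪_𝔭`) together
with the infinite places of `F̄` (archimedean, `𝒪^⊿_𝔭 := {u : |u|_𝔭 ≤ 1}`), primes `𝔭₀ :=` the valuation rings
and the infinite places of `F` (both maps `𝔭 ↦ 𝔭|_F` SURJECTIVE: Chevalley, resp. extension of complex
embeddings to the algebraic closure), `Π_{𝔭₀} :=` the stabiliser of a chosen `𝔭` over `𝔭₀`, `IsNonarch :=`
"`𝔭₀` is a valuation ring" — satisfies the typed printed description `DecompIsStabilizer` at EVERY `𝔭₀`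
(archimedean case: an infinite place is determined by its closed unit ball).  Stated residue: the trivial
valuation ring `F` (resp. `F̄`) is carried as one extra, degenerate nonarchimedean index. ([IUTchI] Ex 5.1 (iv) p.126)
[claim: Mochizuki2012, status: disputed] -/
theorem exists_model_decompIsStabilizer_allPlaces :
    ∃ β : BirationalData (absoluteGaloisGrp F), β.DecompIsStabilizer ∧
      Nonempty (β.Otilde ≃* (AlgebraicClosure F)ˣ) ∧
      Nonempty (β.PrimeIdx ≃
        (ValuationSubring (AlgebraicClosure F) ⊕ NumberField.InfinitePlace (AlgebraicClosure F))) ∧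
      Nonempty (β.PrimeIdx0 ≃ (ValuationSubring F ⊕ NumberField.InfinitePlace F)) := by
  classical
  refine ⟨{ Otilde := (AlgebraicClosure F)ˣ
            otildeAction := Units.mulDistribMulActionRight
            isOpen_stabilizer := isOpen_stabilizer_units F
            PrimeIdx := ValuationSubring (AlgebraicClosure F) ⊕ NumberField.InfinitePlace (AlgebraicClosure F)
            Oint := fun p => p.elim
              (fun (A : ValuationSubring (AlgebraicClosure F)) =>
                A.toSubring.toSubmonoid.comap (Units.coeHom (AlgebraicClosure F)))
              (fun (w : NumberField.InfinitePlace (AlgebraicClosure F)) =>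
                        { carrier := {u : (AlgebraicClosure F)ˣ | w (u : AlgebraicClosure F) ≤ 1}
                          mul_mem' := fun {a b} ha hb => by
                            show w ((a * b : (AlgebraicClosure F)ˣ) : AlgebraicClosure F) ≤ 1
                            rw [Units.val_mul, map_mul]
                            exact mul_le_one₀ ha (apply_nonneg _ _) hb
                          one_mem' := by
                            show w ((1 : (AlgebraicClosure F)ˣ) : AlgebraicClosure F) ≤ 1
                            rw [Units.val_one, map_one] })
            PrimeIdx0 := ValuationSubring F ⊕ NumberField.InfinitePlace F
            over := Sum.map (fun (A : ValuationSubring (AlgebraicClosure F)) =>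
                A.comap (algebraMap F (AlgebraicClosure F)))
              (fun (w : NumberField.InfinitePlace (AlgebraicClosure F)) => w.comap (algebraMap F (AlgebraicClosure F)))
            decomp := fun p₀ => p₀.elim
              (fun (A₀ : ValuationSubring F) => MulAction.stabilizer (absoluteGaloisGrp F)
                (Classical.choose (exists_comap_eq F (AlgebraicClosure F) A₀)))
              (fun (w₀ : NumberField.InfinitePlace F) =>
                (MulAction.stabilizer (AlgebraicClosure F ≃ₐ[F] AlgebraicClosure F)
                (Classical.choose (NumberField.InfinitePlace.comap_surjective (k := F)
                  (K := AlgebraicClosure F) w₀))).comap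
                  (Field.absoluteGaloisGroup.toAlgEquiv F).toMonoidHom)
            IsNonarch := fun p₀ => p₀.isLeft }, ⟨fun p₀ => ?_⟩, ⟨MulEquiv.refl _⟩, ⟨Equiv.refl _⟩,
          ⟨Equiv.refl _⟩⟩
  rcases p₀ with A₀ | w₀
  · refine ⟨Sum.inl (Classical.choose (exists_comap_eq F (AlgebraicClosure F) A₀)),
      congrArg Sum.inl (Classical.choose_spec (exists_comap_eq F (AlgebraicClosure F) A₀)), fun σ => ?_⟩
    show σ ∈ MulAction.stabilizer (absoluteGaloisGrp F) _ ↔ _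
    rw [MulAction.mem_stabilizer_iff, smul_valuationSubring_eq_iff]
    rfl
  · set w := Classical.choose (NumberField.InfinitePlace.comap_surjective (k := F)
      (K := AlgebraicClosure F) w₀) with hw_def
    have hw : w.comap (algebraMap F (AlgebraicClosure F)) = w₀ :=
      Classical.choose_spec (NumberField.InfinitePlace.comap_surjective (k := F) (K := AlgebraicClosure F) w₀)
    refine ⟨Sum.inr w, congrArg Sum.inr hw, fun σ => ?_⟩
    show σ ∈ Subgroup.comap (Field.absoluteGaloisGroup.toAlgEquiv F).toMonoidHom
        (MulAction.stabilizer (AlgebraicClosure F ≃ₐ[F] AlgebraicClosure F) w) ↔ _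
    rw [Subgroup.mem_comap, MulEquiv.coe_toMonoidHom, MulAction.mem_stabilizer_iff,
      smul_infinitePlace_eq_iff]
    constructor
    · intro h x
      exact h x x.ne_zero
    · intro h x hx
      exact h (Units.mk0 x hx)

/-- Instance: over `F_mod := ℚ`, with BOTH the `p`-adic valuation rings and the real place of `ℚ` as primes
`𝔭₀`, each carrying a prime of `ℚ̄` over it and the typed description of `Π_{𝔭₀}`.
([IUTchI] Ex 5.1 (iv) p.126) [claim: Mochizuki2012, status: disputed] -/
example : ∃ β : BirationalData (absoluteGaloisGrp ℚ), β.DecompIsStabilizer ∧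
    Nonempty (β.PrimeIdx0 ≃ (ValuationSubring ℚ ⊕ NumberField.InfinitePlace ℚ)) :=
  (exists_model_decompIsStabilizer_allPlaces ℚ).imp fun _ h => ⟨h.1, h.2.2.2⟩


end BirationalData

end Literature.IUT.HodgeTheaters

end
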